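import Literature.NumberTheory.GaloisCohomology.Howard2004.ResidualLevelControlLocalProofs
import Literature.NumberTheory.GaloisCohomology.Howard2004.DVRSettingLevelTrivialityProofs
import HarnessLib

/-!
# Howard 2004, Lemma 1.6.4 — the Čebotarev step IN THE ENGINE'S CURRENCY: a prime `ℓ ∈ 𝓛^{(2k-1)} ∖ n` seeing two
# residual eigenclasses and their sum, off which `H¹(K_λ, T̄) → H¹(K_λ, T^{(k)})` detects localizations (proofs file)

Topic `NumberTheory/GaloisCohomology/Howard2004` (sequel to `DVRSettingChebotarevEigenclassesProofs` (Lemma 1.6.2 on a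
`DVRSetting`, seat x10b-p1-w6 g8), `ResidualLevelControlLocalProofs` (RES-CTRL) and `DVRSettingLevelTrivialityProofs`
(HTRIV)).  THEOREMS ONLY: no definition, no named fact, no instance, no notation, no `sorry`.

B. Howard, *The Heegner point Kolyvagin system*, Compositio Math. 140 (2004) = arXiv:1202.6340, Lemma 1.6.4, proof,
Cases i/ii (p. 12 L1–27): «choose `ℓ ∈ 𝓛^{(2k−1)}` prime to `n` such that `loc_ℓ(d) ≠ 0` and both `d⁺` and some element of
`H¹_{F(n)}(K, T̄)⁻` have nontrivial localization (Lemma 1.6.2)».  The engine (`StubLemmaInductionProofs`,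
`DVRSettingEngineData.mem_stub_of_stubLemmaInduction_levels'`, binders `hchebI`/`hchebII`) wants the prime IN
`P k = S.enginePrimes k = 𝓛 ∩ 𝓛_{2e_k-1}(T)`, OUTSIDE `n`, with `loc_ℓ d ≠ 0` for the LEVEL-`k` class `d`.  This file
turns Lemma 1.6.2 (`DVRSetting.exists_mem_primes_localization_add_ne_zero`, which produces primes of `𝓛_s(T) ∩ 𝓛` for
ANY large `s`) into exactly that shape:

* §1 `theta_eq_theta` — the residual involution `θ` does not depend on the level (`SatisfiesH.θ_eq` iterated), so
  eigencocycle conditions may be stated at any level.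
* §2 **`exists_mem_enginePrimes_localization_ne_zero`** — for `τ`-eigencocycles `φ⁺, φ⁻` of `T̄` with non-zero
  classes there is `v ∈ S.enginePrimes k`, `v ∉ n`, `v ∉ Σ`, with `loc_v[φ⁺] ≠ 0`, `loc_v[φ⁻] ≠ 0`,
  `loc_v[φ⁺ + φ⁻] ≠ 0` and `Γ_{K_v}` acting trivially on `T^{(k)}` (`s := max(s₀, 2e_k − 1)` with `𝓛_s ⊆ 𝓛` from
  `LargePrimes`; the deep level `j` with `𝔪^{e_j} ≤ (p^s)` from `(p : R) ≠ 0`, `exists_maximalIdeal_pow_e_le_span_pow`;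
  `𝓛_s ⊆ 𝓛_{2e_k−1}` by antitonicity).
* §3 **`localization_cohomologyMap_residualInclusion_ne_zero`** — at such a `v`, `loc_v c̄ ≠ 0 ⇒ loc_v (H¹(ι) c̄) ≠ 0`
  for a residual inclusion `ι : T̄ ↪ T^{(k)}` (RES-CTRL `localization_cohomologyMap_residualInclusion_eq_zero_iff`): the
  passage from the residual class `d̄` back to `d = H¹(ι) d̄` in Lemma 1.6.4.

The `ρ^±`-bookkeeping of `hchebI`/`hchebII` (Lemma 1.5.3) is NOT here (it consumes the parity files once the `ρ^±`
letter is fixed); `hP`/`htors`/`hred`/… are other bricks.  Cell `pub/bsd-print-x9`, G87 = Howard Thm. 1.6.1 (print leaf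
`stub_h161` of stmt-BirchSwinnertonDyer-22642); seat `bsd-line-x10b-p1-w6` g9, brick (ENGINE-hcheb) part 1 (CHEB-CORE).
BSD is not proved by any of this.

References: [Howard2004HeegnerKolyvagin] Lemma 1.6.2, Lemma 1.6.4 (arXiv:1202.6340 p. 11 L30–58, L82 – p. 12 L27).
-/

set_option autoImplicit false

noncomputable section

open Function NumberField IsDedekindDomain Field
open scoped NumberField ContRepresentation Classical

namespace Literature.NumberTheory.GaloisCohomology.Howard2004

open Literature.NumberTheory.GaloisRepresentations
open Literature.NumberTheory.GaloisRepresentations.DiscreteGaloisModule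
open Literature.NumberTheory.EllipticCurves

namespace DVRSetting

variable {p : ℕ} [Fact p.Prime] {K : Type} [Field K] [NumberField K]
  {R : Type} [CommRing R] [IsDomain R] [IsDiscreteValuationRing R] [Algebra ℤ_[p] R]
  {N : ℕ → Type} [∀ k, AddCommGroup (N k)] [∀ k, TopologicalSpace (N k)]
  [∀ k, DiscreteTopology (N k)] [∀ k, Module R (N k)]
  {Rk : ℕ → Type} [∀ k, CommRing (Rk k)] [∀ k, IsLocalRing (Rk k)] [∀ k, TopologicalSpace (Rk k)]
  [∀ k, DiscreteTopology (Rk k)] [∀ k, Algebra ℤ_[p] (Rk k)] [∀ k, Algebra R (Rk k)]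
  [∀ k, Module (Rk k) (N k)] [∀ k, IsScalarTower R (Rk k) (N k)]
  {Nbar : Type} [AddCommGroup Nbar] [TopologicalSpace Nbar] [DiscreteTopology Nbar]
  [∀ k, Module (Rk k) Nbar]
  {Nq : ℕ → Finset (HeightOneSpectrum (𝓞 K)) → Type} [∀ k n, AddCommGroup (Nq k n)]
  [∀ k n, TopologicalSpace (Nq k n)] [∀ k n, DiscreteTopology (Nq k n)]
  [∀ k n, Module (Rk k) (Nq k n)] [∀ k n, Module R (Nq k n)]
  [∀ k n, IsScalarTower R (Rk k) (Nq k n)]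

/-! ## §1 The residual involution `θ` is level-independent -/

/-- `θ` is the same map at every level («one `θ`», `SatisfiesH.θ_eq` iterated). [cite: Howard2004HeegnerKolyvagin, H.5(a) (arXiv:1202.6340 p. 7 L93–95)] -/
theorem theta_eq_theta (S : DVRSetting p K R N Rk Nbar Nq) (hy : S.SatisfiesH) (i j : ℕ) (x : Nbar) :
    (S.A i).θ x = (S.A j).θ x := by
  have h0 : ∀ m, (S.A m).θ x = (S.A 0).θ x := by
    intro m
    induction m with
    | zero => rfl
    | succ m ih => rw [hy.θ_eq m x, ih]
  rw [h0 i, h0 j]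

/-! ## §2 The prime of Lemma 1.6.2 inside `S.enginePrimes k`, outside `n` -/

/-- **The Čebotarev prime of Lemma 1.6.4 in the engine's currency.**  On a `DVRSetting` with H.0–H.5, `𝓛_s ⊆ 𝓛` for
`s ≫ 0` (`LargePrimes`) and `(p : R) ≠ 0`, given `τ`-eigencocycles `φ⁺, φ⁻` of `T̄` (for the `θ` of any level `i`)
with non-zero classes and a finite set `n` of primes, there is a prime `v ∈ S.enginePrimes k = 𝓛 ∩ 𝓛_{2e_k−1}(T)` with
`v ∉ n`, `v ∉ Σ(F)`, `loc_v[φ⁺] ≠ 0`, `loc_v[φ⁻] ≠ 0`, `loc_v[φ⁺ + φ⁻] ≠ 0`, at which `Γ_{K_v}` acts trivially on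
`T^{(k)}`. [cite: Howard2004HeegnerKolyvagin, Lemma 1.6.2 and Lemma 1.6.4, Cases i/ii (arXiv:1202.6340 p. 11 L30–58, p. 12 L1–27)] -/
theorem exists_mem_enginePrimes_localization_ne_zero [Finite Nbar] [∀ k, Finite (N k)]
    (S : DVRSetting p K R N Rk Nbar Nq) (hy : S.SatisfiesH) (hC : Automorphic.chebotarev_artinRep)
    (hp0 : ((p : ℕ) : R) ≠ 0) (hL : S.LargePrimes) (k i : ℕ) (n : Finset (HeightOneSpectrum (𝓞 K)))
    (φp φm : contOneCocycles S.ρbar.toTopRep)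
    (hφp : ∀ g, φp.1 (S.cd.conj g) = (S.A i).θ (φp.1 g))
    (hφm : ∀ g, φm.1 (S.cd.conj g) = -(S.A i).θ (φm.1 g))
    (hcp : oneCocycleClass S.ρbar.toTopRep φp ≠ 0) (hcm : oneCocycleClass S.ρbar.toTopRep φm ≠ 0) :
    ∃ v : HeightOneSpectrum (𝓞 K), v ∈ S.enginePrimes k ∧ v ∉ n ∧ (Sum.inr v : Place K) ∉ S.Sigma ∧
      galoisCohomology.localization S.ρbar (Sum.inr v) 1 (oneCocycleClass S.ρbar.toTopRep φp) ≠ 0 ∧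
      galoisCohomology.localization S.ρbar (Sum.inr v) 1 (oneCocycleClass S.ρbar.toTopRep φm) ≠ 0 ∧
      galoisCohomology.localization S.ρbar (Sum.inr v) 1 (oneCocycleClass S.ρbar.toTopRep (φp + φm)) ≠ 0 ∧
      ∀ (σ : absoluteGaloisGroup (v.adicCompletion K)) (y : N k), GaloisRep.toLocal v (S.T.ρ k) σ y = y := by
  classical
  obtain ⟨s₀, hs₀⟩ := hL
  set s : ℕ := max s₀ (2 * S.e k - 1) with hs
  have hLs : S.T.kolyvaginPrimes p s ⊆ S.L := hs₀ s (le_max_left _ _)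
  obtain ⟨j, hj⟩ := S.exists_maximalIdeal_pow_e_le_span_pow hy hp0 s
  -- eigencocycle conditions at the level `j` of Lemma 1.6.2
  have hφp' : ∀ g, φp.1 (S.cd.conj g) = (S.A j).θ (φp.1 g) := fun g => by
    rw [hφp g, S.theta_eq_theta hy i j]
  have hφm' : ∀ g, φm.1 (S.cd.conj g) = -(S.A j).θ (φm.1 g) := fun g => by
    rw [hφm g, S.theta_eq_theta hy i j]
  obtain ⟨v, hvn, hvSig, hvL, hvs, -, -, -, -, -, -, -, hp', hm', hsum⟩ :=
    S.exists_mem_primes_localization_add_ne_zero hy hC hLs hj φp φm hφp' hφm' hcp hcm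
      (S₀ := (↑n : Set (HeightOneSpectrum (𝓞 K)))) n.finite_toSet
  have hvP : v ∈ S.enginePrimes k :=
    ⟨hvL, S.T.kolyvaginPrimes_antitone p (le_max_right s₀ (2 * S.e k - 1)) hvs⟩
  refine ⟨v, hvP, fun h => hvn (Finset.mem_coe.2 h), hvSig, hp', hm', hsum, fun σ y => ?_⟩
  -- `Γ_{K_v}` acts trivially on `T^{(k)}` at a prime of `𝓛^{(2k-1)}` (HTRIV, with the singleton `{v}`)
  have h1 : 0 < S.e k := hy.e_zero.trans_le (hy.e_strictMono.monotone (Nat.zero_le k))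
  exact S.toLocal_apply_eq_self_of_subset_enginePrimes hy (k := k) (j := k) (by omega) (n := {v})
    (fun w hw => by rw [Finset.coe_singleton, Set.mem_singleton_iff] at hw; rw [hw]; exact hvP)
    (Finset.mem_singleton_self v) σ y

/-! ## §3 Back to the level `k`: `loc_v d̄ ≠ 0 ⇒ loc_v d ≠ 0` for `d = H¹(ι) d̄` -/

/-- **At a prime where `Γ_{K_v}` acts trivially on `T^{(k)}`, the residual inclusion detects localizations**: for a
residual inclusion `ι : T̄ → T^{(k)}` (`ι ∘ π̄_k = π^{e_k−1}`, equivariant) and `c̄ ∈ H¹(K, T̄)` with `loc_v c̄ ≠ 0`, also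
`loc_v (H¹(ι) c̄) ≠ 0` (RES-CTRL `localization_cohomologyMap_residualInclusion_eq_zero_iff`) — the step «`loc_ℓ(d̄) ≠ 0`,
hence `loc_ℓ(d) ≠ 0`» of Lemma 1.6.4. [cite: Howard2004HeegnerKolyvagin, Lemma 1.6.4 proof (arXiv:1202.6340 p. 12 L2–9)] -/
theorem localization_cohomologyMap_residualInclusion_ne_zero (S : DVRSetting p K R N Rk Nbar Nq) (hy : S.SatisfiesH)
    (k : ℕ) (ι : Nbar →ₗ[Rk k] N k) (hι : ∀ y : N k, ι (S.πbar k y) = S.π ^ (S.e k - 1) • y)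
    (hequiv : ∀ (σ : absoluteGaloisGroup K) (x : Nbar), ι (S.ρbar σ x) = S.T.ρ k σ (ι x))
    (v : HeightOneSpectrum (𝓞 K))
    (htrivv : ∀ (g : absoluteGaloisGroup (v.adicCompletion K)) (y : N k), GaloisRep.toLocal v (S.T.ρ k) g y = y)
    {c : galoisCohomology S.ρbar 1} (hc : galoisCohomology.localization S.ρbar (Sum.inr v) 1 c ≠ 0) :
    galoisCohomology.localization (S.T.ρ k) (Sum.inr v) 1
        (ContinuousRep.cohomologyMap S.ρbar (S.T.ρ k) ι.toAddMonoidHom continuous_of_discreteTopology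
          hequiv 1 c) ≠ 0 :=
  fun h => hc ((S.localization_cohomologyMap_residualInclusion_eq_zero_iff hy k ι hι hequiv v htrivv c).1 h)

/-- **The Čebotarev prime together with the level-`k` localization**: with the data of
`exists_mem_enginePrimes_localization_ne_zero` and a residual inclusion `ι`, for every `c̄ ∈ H¹(K, T̄)` which is ONE OF
`[φ⁺]`, `[φ⁻]`, `[φ⁺ + φ⁻]` the prime `v` also has `loc_v (H¹(ι) c̄) ≠ 0` — the form used for `d = H¹(ι) d̄` with
`d̄ = d̄⁺ + d̄⁻` (both non-zero), `d̄ = d̄⁺` or `d̄ = d̄⁻` in Cases i/ii of Lemma 1.6.4.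
[cite: Howard2004HeegnerKolyvagin, Lemma 1.6.4, Cases i/ii (arXiv:1202.6340 p. 12 L1–27)] -/
theorem exists_mem_enginePrimes_localization_cohomologyMap_ne_zero [Finite Nbar] [∀ k, Finite (N k)]
    (S : DVRSetting p K R N Rk Nbar Nq) (hy : S.SatisfiesH) (hC : Automorphic.chebotarev_artinRep)
    (hp0 : ((p : ℕ) : R) ≠ 0) (hL : S.LargePrimes) (k i : ℕ) (n : Finset (HeightOneSpectrum (𝓞 K)))
    (ι : Nbar →ₗ[Rk k] N k) (hι : ∀ y : N k, ι (S.πbar k y) = S.π ^ (S.e k - 1) • y)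
    (hequiv : ∀ (σ : absoluteGaloisGroup K) (x : Nbar), ι (S.ρbar σ x) = S.T.ρ k σ (ι x))
    (φp φm : contOneCocycles S.ρbar.toTopRep)
    (hφp : ∀ g, φp.1 (S.cd.conj g) = (S.A i).θ (φp.1 g))
    (hφm : ∀ g, φm.1 (S.cd.conj g) = -(S.A i).θ (φm.1 g))
    (hcp : oneCocycleClass S.ρbar.toTopRep φp ≠ 0) (hcm : oneCocycleClass S.ρbar.toTopRep φm ≠ 0) :
    ∃ v : HeightOneSpectrum (𝓞 K), v ∈ S.enginePrimes k ∧ v ∉ n ∧ (Sum.inr v : Place K) ∉ S.Sigma ∧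
      galoisCohomology.localization S.ρbar (Sum.inr v) 1 (oneCocycleClass S.ρbar.toTopRep φp) ≠ 0 ∧
      galoisCohomology.localization S.ρbar (Sum.inr v) 1 (oneCocycleClass S.ρbar.toTopRep φm) ≠ 0 ∧
      (∀ c : galoisCohomology S.ρbar 1,
        (c = oneCocycleClass S.ρbar.toTopRep φp ∨ c = oneCocycleClass S.ρbar.toTopRep φm ∨
          c = oneCocycleClass S.ρbar.toTopRep (φp + φm)) →
        galoisCohomology.localization (S.T.ρ k) (Sum.inr v) 1
          (ContinuousRep.cohomologyMap S.ρbar (S.T.ρ k) ι.toAddMonoidHom continuous_of_discreteTopology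
            hequiv 1 c) ≠ 0) := by
  obtain ⟨v, hvP, hvn, hvSig, hp', hm', hsum, htrivv⟩ :=
    S.exists_mem_enginePrimes_localization_ne_zero hy hC hp0 hL k i n φp φm hφp hφm hcp hcm
  refine ⟨v, hvP, hvn, hvSig, hp', hm', fun c hc => ?_⟩
  rcases hc with rfl | rfl | rfl
  · exact S.localization_cohomologyMap_residualInclusion_ne_zero hy k ι hι hequiv v htrivv hp'
  · exact S.localization_cohomologyMap_residualInclusion_ne_zero hy k ι hι hequiv v htrivv hm'
  · exact S.localization_cohomologyMap_residualInclusion_ne_zero hy k ι hι hequiv v htrivv hsum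

end DVRSetting

end Literature.NumberTheory.GaloisCohomology.Howard2004

end
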